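import Summits.QuantumFields.QCD.Theses.CentreStabilisedCircle

/-!
# `CFCCentreStability` follows from any distance-free (perimeter-type) bound on the undeformed
# bare Polyakov-loop correlator

Helper file for item stmt-QuantumFields-10528 (`CFCCentreStability`, route
`CentreStabilisedCircle`, sub-problem `QCD` of `QuantumFields`).  It records, as a checked
implication, the structural observation behind the refuter flag carried in the item's docstring
("the BARE correlator is UV-blunt along an AF trajectory (perimeter self-energy)"): the item is
implied by the statement `PerimeterDecay` below, in which

* the deformation profile is identically `0` (no centre stabilisation anywhere),
* there is NO large-separation clause: the bound `‖⟨tr P_0 · conj tr P_x⟩‖ ≤ ε` is demanded at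
  EVERY separation `x` with `|x|_∞ ≥ 1`, eventually in `k`, uniformly in `N_t ≥ ℓ₀/a_k` and `S`.

A perimeter-law upper bound of Simon–Yaffe type, `|⟨tr P_0 conj tr P_x⟩| ≤ 9 θ(β_k)^{2N_t}` with
`N_t ≥ ℓ₀/a_k → ∞` faster than `(1 − θ(β_k))⁻¹`, is exactly of this distance-free form wherever the
Boltzmann weight is positive; so wherever `CFCCentreStability` is provable through such a bound,
its clause "`→ 0` as `|x|_∞ → ∞`" is idle (`r = 1`) and carries no information about
colour-flavour-centre long-range order.  (The theorem below is pure logic: `hP ≡ 0`, `ℓ₁ = 0`,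
`r = 1`.)

Pure theorem file: no definitions (the hypothesis is written out in the signature).
-/

namespace Summit.QuantumFields.QCD.Theorems.CentreStabilisedCircleCFC

open Literature.MathematicalPhysics.QuantumLattice Literature.MathematicalPhysics.QuantumFieldTheory
open Filter

/-- **Distance-free decay implies `CFCCentreStability`.**  If along every admissible
regularisation, above a mass threshold, for every `ℓ₀ > 0` some twist offset `θ̄` makes the
UNDEFORMED (`h = 0`) bare Polyakov-loop two-point function `⟨tr P_0 · conj tr P_x⟩` eventually
(in `k`) `ε`-small at EVERY separation `x ≢ 0` (`|x|_∞ ≥ 1`), uniformly in `N_t ≥ ℓ₀/a_k` and in the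
spatial torus — a perimeter-type statement with no large-distance content — then the route's item
`CFCCentreStability` holds (with the profile `hP ≡ 0`, `ℓ₁ = 0`, `r = 1`). -/
theorem CFCCentreStability_of_perimeterDecay
    (H : ∀ reg : QCDRegularisation 3, reg.HasMassScaling → (reg.scheme 0 0 0).HasAsymptoticScaling →
      ∃ M₀ : ℝ, 0 ≤ M₀ ∧ ∀ μ : ℝ, M₀ < μ →
        (∀ᶠ k in atTop, -1 < (reg.scheme (fun _ => μ) 0 0).mq 0 k) → ∀ ℓ₀ : ℝ, 0 < ℓ₀ →
        ∃ θb : ℝ, ∀ ε : ℝ, 0 < ε → ∀ᶠ k in atTop, ∀ (Nt : ℕ) [NeZero Nt], ℓ₀ ≤ reg.a k * Nt →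
          ∀ S : ℕ, Nt ≤ 2 * S + 1 → ∀ x : Fin 3 → ℤ, (∀ i, |x i| ≤ S) → (∃ i, (1 : ℤ) ≤ |x i|) →
            ‖qcdCircleExpect (Nf := 3) Nt (2 * S + 1) (reg.β k) 0
                (fun f => (reg.scheme (fun _ => μ) 0 0).mq f k)
                (fun f => θb + 2 * Real.pi * (f : ℝ) / 3)
                (fun U => algebraMap ℂ (CircleFermiAlg 3 Nt (2 * S + 1))
                  (SlabGauge.polyakovTrace (fundamentalRep (Fin 3)) U 0 *
                    (starRingEnd ℂ) (SlabGauge.polyakovTrace (fundamentalRep (Fin 3)) U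
                      (fun i => ((x i : ℤ) : ZMod (2 * S + 1))))))‖ ≤ ε) :
    Summit.QuantumFields.QCD.Theses.CentreStabilisedCircle.CFCCentreStability := by
  intro reg hms has
  obtain ⟨M₀, hM₀, hM⟩ := H reg hms has
  refine ⟨M₀, hM₀, fun μ hμ hbr ℓ₀ hℓ₀ => ?_⟩
  obtain ⟨θb, hθ⟩ := hM μ hμ hbr ℓ₀ hℓ₀
  refine ⟨θb, 0, fun _ _ => 0, fun _ _ _ => rfl, fun ε hε => ⟨1, ?_⟩⟩
  filter_upwards [hθ ε hε] with k hk Nt _ hNt S hS x hxS hxr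
  have hxr' : ∃ i, (1 : ℤ) ≤ |x i| := by
    obtain ⟨i, hi⟩ := hxr
    exact ⟨i, by exact_mod_cast hi⟩
  exact hk Nt hNt S hS x hxS hxr'

end Summit.QuantumFields.QCD.Theorems.CentreStabilisedCircleCFC
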